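import Summits.QuantumFields.YangMills.Theses.SmallFieldWidening

/-!
# Route `SmallFieldWidening` (QuantumFields / YangMills; rung-R3 leaf `T3YM3TorusStatement.YM3TorusSU2`) — THE WIDENING
# (support item `WideningOfTiltAndMass`, stmt-QuantumFields-22885), PROVED

WHAT THIS IS NOT: not a proof of the route's cruxes r2 (`AllHeightsSmallTilt`) or r3 (`LargeFieldMassRefinementTail`) — the
d = 3 expectations step E3 stays open —, not d = 4, not a mass gap, not Clay.  It is the route's provable plumbing: the
Moore–Osgood / «approximately Cauchy» widening that turns «all-heights unit tilt with summable radii at every refinement depth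
`n ≥ n₀`» + «ONE `K`-uniform large-field mass `δ n → 0`» into `HasContinuumLimit (F.scheme ℰp γ)` for the ORIGINAL family.

THE ARGUMENT ([King1986] (3.9)–(3.13) «Cauchy in K», with the summable bad masses replaced by a `K`-uniform one).
§1 Pure measure theory.  `IsTilt` is stable under rescaling both measures by finite constants (`isTilt_smul_measure`), so the
   NORMALISED good parts of two consecutive runs are again tilt-related with the same radius and the tree's four-measure lemma
   (`IsTilt.abs_integral_sub_le`, zero bad parts) bounds the increment of the normalised good expectations of any measurable
   `|W| ≤ 1` by `8 r_K` (`abs_integral_normalize_sub_le_of_isTilt`).  If probability laws `P_K = μ_K + μ'_K` have bad masses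
   `μ'_K(univ) ≤ δ < 1` uniformly in `K` and consecutive good parts tilt-related with summable radii, the normalised good
   expectations `b_K` are CAUCHY and `|∫ W dP_K − b_K| ≤ 2δ` for every `K` (bad part `≤ δ`, normalisation defect `≤ δ`):
   `exists_cauchySeq_near_integral`.
§2 Real sequences: a sequence whose shifted tails are, for every `ε`, uniformly `ε`-close to SOME Cauchy sequence is Cauchy
   (`cauchySeq_of_forall_near_cauchySeq`, an `ε/4 + ε/2 + ε/4` argument).
§3 The item: for `ε > 0` pick `n ≥ n₀` with `δ n < min (ε/2) 1`; the refined family `F.refine n` at `γL^{-n}` supplies the laws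
   of §1 (`unitLaw_eq_map_restrict_add` along `histGood … K 0`; at `m = 0` the K1 body `UnitTiltAt … 0` compares EXACTLY these
   events since `K / 0 = 0`), and the original family's expectations from index `n` on are the integrals of the bounded measurable
   `coarseObs` against those laws (`expectAt_refine`).  Hence the expectation sequence is Cauchy, hence convergent.
-/

noncomputable section

open MeasureTheory Filter Topology
open scoped ENNReal
open Literature.MathematicalPhysics.QuantumFieldTheory.Balaban1983to89
open Literature.MathematicalPhysics.QuantumFieldTheory.Balaban1983to89.Missing
open Literature.MathematicalPhysics.QuantumFieldTheory.Balaban1983to89.T3ContinuumYM3Torus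
open Literature.MathematicalPhysics.QuantumFieldTheory.Balaban1983to89.T3ThresholdRemoval
open Literature.MathematicalPhysics.QuantumFieldTheory.Balaban1983to89.T3UnitLawDensityEML (ℰp measurableE_ℰp)
open Literature.MathematicalPhysics.QuantumFieldTheory.Balaban1983to89.T3UnitScaleTilt

namespace Summit.QuantumFields.YangMills.Theorems

/-! ## §1 Pure measure theory: normalised good parts of tilt-related laws -/

section Abstract

variable {X : Type*} [MeasurableSpace X]

/-- **TILTS ARE STABLE UNDER RESCALING**: if `ν = C·e^{h}·μ` (`sup |h| ≤ r`) then `b•ν = (bC/a)·e^{h}·(a•μ)` for finite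
constants `a ≠ 0`, `b` — the same log-density, hence the same radius.  Used to pass to NORMALISED good parts. -/
theorem isTilt_smul_measure {μ ν : Measure X} {r : ℝ} (h : IsTilt μ ν r) {a b : ℝ≥0∞} (ha0 : a ≠ 0)
    (ha : a ≠ ∞) (hb : b ≠ ∞) : IsTilt (a • μ) (b • ν) r := by
  obtain ⟨hr, g, C, hgm, hC, hg, hν⟩ := h
  have haR : 0 < a.toReal := ENNReal.toReal_pos ha0 ha
  have haR' : a.toReal ≠ 0 := haR.ne'
  refine ⟨hr, g, b.toReal * C / a.toReal, hgm,
    div_nonneg (mul_nonneg ENNReal.toReal_nonneg hC) haR.le, hg, ?_⟩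
  have hm : Measurable fun x => ENNReal.ofReal (C * Real.exp (g x)) :=
    ((Real.measurable_exp.comp hgm).const_mul C).ennreal_ofReal
  have hm' : Measurable fun x => ENNReal.ofReal (b.toReal * C / a.toReal * Real.exp (g x)) :=
    ((Real.measurable_exp.comp hgm).const_mul _).ennreal_ofReal
  rw [withDensity_smul_measure, hν, ← withDensity_smul b hm, ← withDensity_smul a hm']
  congr 1
  funext x
  show b * ENNReal.ofReal (C * Real.exp (g x)) =
    a * ENNReal.ofReal (b.toReal * C / a.toReal * Real.exp (g x))
  have ea : ENNReal.ofReal a.toReal = a := ENNReal.ofReal_toReal ha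
  have eb : ENNReal.ofReal b.toReal = b := ENNReal.ofReal_toReal hb
  calc b * ENNReal.ofReal (C * Real.exp (g x))
      = ENNReal.ofReal b.toReal * ENNReal.ofReal (C * Real.exp (g x)) := by rw [eb]
    _ = ENNReal.ofReal (b.toReal * (C * Real.exp (g x))) := (ENNReal.ofReal_mul ENNReal.toReal_nonneg).symm
    _ = ENNReal.ofReal (a.toReal * (b.toReal * C / a.toReal * Real.exp (g x))) := by
        congr 1; field_simp
    _ = ENNReal.ofReal a.toReal * ENNReal.ofReal (b.toReal * C / a.toReal * Real.exp (g x)) :=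
        ENNReal.ofReal_mul ENNReal.toReal_nonneg
    _ = a * ENNReal.ofReal (b.toReal * C / a.toReal * Real.exp (g x)) := by rw [ea]

/-- **CONSECUTIVE NORMALISED GOOD EXPECTATIONS**: if the finite non-zero measure `ν` is a tilt of radius `r` of the finite
non-zero `μ`, then for every measurable `|W| ≤ 1` the NORMALISED integrals differ by at most `8r` (the tree's four-measure
lemma `IsTilt.abs_integral_sub_le` with empty bad parts, applied to the rescaled pair). -/
theorem abs_integral_normalize_sub_le_of_isTilt {μ ν : Measure X} [IsFiniteMeasure μ] [IsFiniteMeasure ν] [NeZero μ]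
    [NeZero ν] {r : ℝ} (h : IsTilt μ ν r) {W : X → ℝ} (hWm : Measurable W) (hW : ∀ x, |W x| ≤ 1) :
    |(∫ x, W x ∂((ν Set.univ)⁻¹ • ν)) - ∫ x, W x ∂((μ Set.univ)⁻¹ • μ)| ≤ 8 * r := by
  have ht : IsTilt ((μ Set.univ)⁻¹ • μ) ((ν Set.univ)⁻¹ • ν) r :=
    isTilt_smul_measure h (ENNReal.inv_ne_zero.mpr (measure_ne_top μ _))
      (ENNReal.inv_ne_top.mpr (NeZero.ne (μ Set.univ)))
      (ENNReal.inv_ne_top.mpr (NeZero.ne (ν Set.univ)))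
  haveI i1 : IsProbabilityMeasure ((μ Set.univ)⁻¹ • μ + 0) := by rw [add_zero]; infer_instance
  haveI i2 : IsProbabilityMeasure ((ν Set.univ)⁻¹ • ν + 0) := by rw [add_zero]; infer_instance
  have key := IsTilt.abs_integral_sub_le (μb := 0) (νb := 0) (w := 0) (w' := 0) ht (by simp) (by simp) hWm hW
  simp only [add_zero, mul_zero] at key
  exact key

/-- Elementary: `0 < Z ≤ 1`, `1 − Z ≤ δ`, `|I| ≤ Z`, `|I'| ≤ δ` ⇒ `|I + I' − I/Z| ≤ 2δ` (bad part plus normalisation defect). -/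
theorem abs_add_sub_inv_mul_le {Z I I' δ : ℝ} (hZ : 0 < Z) (hZ1 : Z ≤ 1) (h1Z : 1 - Z ≤ δ) (hI : |I| ≤ Z)
    (hI' : |I'| ≤ δ) : |I + I' - Z⁻¹ * I| ≤ 2 * δ := by
  have hZ1 : 0 ≤ 1 - Z := by linarith
  have hq : |Z⁻¹ * I| ≤ 1 := by
    rw [abs_mul, abs_inv, abs_of_pos hZ, inv_mul_le_iff₀ hZ, mul_one]
    exact hI
  have e : I + I' - Z⁻¹ * I = -(Z⁻¹ * I * (1 - Z)) + I' := by
    field_simp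
    ring
  rw [e]
  calc |-(Z⁻¹ * I * (1 - Z)) + I'| ≤ |-(Z⁻¹ * I * (1 - Z))| + |I'| := abs_add_le _ _
    _ = |Z⁻¹ * I| * (1 - Z) + |I'| := by rw [abs_neg, abs_mul, abs_of_nonneg hZ1]
    _ ≤ 1 * δ + δ := add_le_add (mul_le_mul hq h1Z hZ1 zero_le_one) hI'
    _ = 2 * δ := by ring

/-- **APPROXIMATELY CAUCHY EXPECTATIONS** ([King1986] (3.9)–(3.13) with a `K`-UNIFORM bad mass instead of a summable one):
probability laws `P_K = μ_K + μ'_K` with `μ'_K(univ) ≤ δ < 1` for all `K` and `μ_{K+1}` a tilt of `μ_K` of radius `r_K`,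
`Σ r_K < ∞`.  Then for every measurable `|W| ≤ 1` there is a CAUCHY sequence `b` (the normalised good expectations) with
`|∫ W dP_K − b_K| ≤ 2δ` for every `K`. -/
theorem exists_cauchySeq_near_integral (P μ μ' : ℕ → Measure X) (hPp : ∀ K, IsProbabilityMeasure (P K))
    (hP : ∀ K, P K = μ K + μ' K) {δ : ℝ} (hδ : ∀ K, (μ' K).real Set.univ ≤ δ) (hδ1 : δ < 1)
    {r : ℕ → ℝ} (hr : Summable r) (ht : ∀ K, IsTilt (μ K) (μ (K + 1)) (r K))
    {W : X → ℝ} (hWm : Measurable W) (hW : ∀ x, |W x| ≤ 1) :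
    ∃ b : ℕ → ℝ, CauchySeq b ∧ ∀ K, |(∫ x, W x ∂P K) - b K| ≤ 2 * δ := by
  have hle : ∀ K, μ K ≤ P K := fun K => by rw [hP K]; exact Measure.le_add_right le_rfl
  have hle' : ∀ K, μ' K ≤ P K := fun K => by rw [hP K]; exact Measure.le_add_left le_rfl
  haveI hfin : ∀ K, IsFiniteMeasure (μ K) := fun K => isFiniteMeasure_of_le (P K) (hle K)
  haveI hfin' : ∀ K, IsFiniteMeasure (μ' K) := fun K => isFiniteMeasure_of_le (P K) (hle' K)
  have hmass : ∀ K, (μ K).real Set.univ + (μ' K).real Set.univ = 1 := fun K => by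
    rw [← measureReal_add_apply (μ₁ := μ K) (μ₂ := μ' K) (s := Set.univ) (measure_ne_top _ _)
      (measure_ne_top _ _), ← hP K, probReal_univ]
  have hZpos : ∀ K, 0 < (μ K).real Set.univ := fun K => by linarith [hmass K, hδ K]
  haveI hne : ∀ K, NeZero (μ K) := fun K =>
    ⟨fun h0 => (hZpos K).ne' (by rw [h0]; exact measureReal_zero_apply _)⟩
  have hbd : ∀ (κ : Measure X) [IsFiniteMeasure κ], |∫ x, W x ∂κ| ≤ κ.real Set.univ := fun κ _ => by
    have h1 := norm_integral_le_of_norm_le_const (μ := κ) (C := 1) (f := W)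
      (ae_of_all _ fun x => by rw [Real.norm_eq_abs]; exact hW x)
    rwa [Real.norm_eq_abs, one_mul] at h1
  have hint : ∀ (κ : Measure X) [IsFiniteMeasure κ], Integrable W κ := fun κ _ =>
    (integrable_const (1 : ℝ)).mono' hWm.aestronglyMeasurable
      (ae_of_all _ fun x => by rw [Real.norm_eq_abs]; exact hW x)
  refine ⟨fun K => ∫ x, W x ∂(((μ K) Set.univ)⁻¹ • μ K), ?_, fun K => ?_⟩
  · refine cauchySeq_of_dist_le_of_summable _ (fun K => ?_) (hr.mul_left 8)
    rw [Real.dist_eq, abs_sub_comm]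
    exact abs_integral_normalize_sub_le_of_isTilt (ht K) hWm hW
  · show |(∫ x, W x ∂P K) - ∫ x, W x ∂(((μ K) Set.univ)⁻¹ • μ K)| ≤ 2 * δ
    rw [integral_smul_measure, ENNReal.toReal_inv, smul_eq_mul, ← measureReal_def, hP K,
      integral_add_measure (hint _) (hint _)]
    exact abs_add_sub_inv_mul_le (hZpos K)
      (by linarith [hmass K, measureReal_nonneg (μ := μ' K) (s := Set.univ)])
      (by linarith [hmass K, hδ K]) (hbd (μ K)) ((hbd (μ' K)).trans (hδ K))

end Abstract

/-! ## §2 Real sequences: uniformly near Cauchy sequences along shifted tails ⇒ Cauchy -/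

/-- A real sequence `a` such that for every `ε > 0` some shifted tail `K ↦ a (K + n)` is uniformly `ε`-close to a Cauchy
sequence is itself Cauchy (the iterated-limit / Moore–Osgood device in `ε/4 + ε/2 + ε/4` form). -/
theorem cauchySeq_of_forall_near_cauchySeq {a : ℕ → ℝ}
    (h : ∀ ε : ℝ, 0 < ε → ∃ (n : ℕ) (b : ℕ → ℝ), CauchySeq b ∧ ∀ K, |a (K + n) - b K| ≤ ε) :
    CauchySeq a := by
  refine Metric.cauchySeq_iff.mpr fun ε hε => ?_
  obtain ⟨n, b, hb, hnear⟩ := h (ε / 4) (by positivity)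
  obtain ⟨M, hM⟩ := Metric.cauchySeq_iff.mp hb (ε / 2) (half_pos hε)
  refine ⟨M + n, fun m hm k hk => ?_⟩
  obtain ⟨i, rfl⟩ := Nat.exists_eq_add_of_le hm
  obtain ⟨j, rfl⟩ := Nat.exists_eq_add_of_le hk
  have e1 : M + n + i = (M + i) + n := by ring
  have e2 : M + n + j = (M + j) + n := by ring
  rw [e1, e2, Real.dist_eq]
  have h1 := hnear (M + i)
  have h2 := hnear (M + j)
  have h3 := hM (M + i) (Nat.le_add_right M i) (M + j) (Nat.le_add_right M j)
  rw [Real.dist_eq] at h3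
  rw [abs_sub_comm] at h2
  calc |a (M + i + n) - a (M + j + n)|
      = |(a (M + i + n) - b (M + i)) + (b (M + i) - b (M + j)) + (b (M + j) - a (M + j + n))| := by
        congr 1; ring
    _ ≤ |a (M + i + n) - b (M + i)| + |b (M + i) - b (M + j)| + |b (M + j) - a (M + j + n)| :=
        abs_add_three _ _ _
    _ < ε := by linarith

/-! ## §3 The item -/

/-- **THE WIDENING, PROVED** (route `SmallFieldWidening`, support item `WideningOfTiltAndMass`): for a three-torus family `F`,
`γ > 0`, a Bałaban profile `(b₀, p₀)` and a depth `n₀` — if for every `n ≥ n₀` the refined family `F.refine n` at coupling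
`γL^{-n}` has the ALL-HEIGHTS unit tilt with summable radii (`UnitTiltAt … 0`), and ONE sequence `δ n → 0` bounds the Gibbs
masses of the complements of the all-heights small-field events of ALL its runs `K` (for `n ≥ n₀`), then the ORIGINAL family's
joint expectations of unit-scale averaged Wilson loops converge along the full sequence of spacings:
`HasContinuumLimit (F.scheme ℰp γ)`.  (No crux of the route and no summit is proved here; the YM mass gap is untouched.) -/
theorem smallFieldWidening_wideningOfTiltAndMass_proof :
    Summit.QuantumFields.YangMills.Theses.SmallFieldWidening.WideningOfTiltAndMass := by
  intro F γ b₀ p₀ n₀ hγ hT hM Cs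
  obtain ⟨δ, hδ, hmass⟩ := hM
  suffices hcs : CauchySeq fun K => (F.scheme ℰp γ).expectAt K Cs from cauchySeq_tendsto_of_complete hcs
  refine cauchySeq_of_forall_near_cauchySeq fun ε hε => ?_
  -- a refinement depth `n ≥ n₀` with `δ n < min (ε/2) 1`
  obtain ⟨n, hn₀, hn⟩ : ∃ n, n₀ ≤ n ∧ δ n < min (ε / 2) 1 := by
    obtain ⟨n, hn⟩ := ((hδ.eventually (gt_mem_nhds (lt_min (half_pos hε) one_pos))).and
      (eventually_ge_atTop n₀)).exists
    exact ⟨n, hn.2, hn.1⟩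
  have hγ' : 0 ≤ γ * ((F.L : ℝ)⁻¹) ^ n := mul_nonneg hγ.le (pow_nonneg (inv_nonneg.mpr (Nat.cast_nonneg _)) n)
  obtain ⟨r, hr, htilt⟩ := hT n hn₀
  -- §1 for the refined family's unit laws split along the all-heights small-field events
  have hGd : ∀ K, MeasurableSet (histGood (F.refine n) ℰp
      (θBal (F.refine n).L (γ * ((F.L : ℝ)⁻¹) ^ n) b₀ p₀) K 0) := fun K =>
    measurableSet_histGood (F.refine n) ℰp measurableE_ℰp _ K 0
  obtain ⟨b, hb, hnear⟩ := exists_cauchySeq_near_integral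
    (fun K => (F.refine n).unitLaw ℰp measurableE_ℰp (γ * ((F.L : ℝ)⁻¹) ^ n) K)
    (fun K => Measure.map (unitA (F.refine n) ℰp K)
      ((gibbsK (F.refine n) ℰp (γ * ((F.L : ℝ)⁻¹) ^ n) K).restrict
        (histGood (F.refine n) ℰp (θBal (F.refine n).L (γ * ((F.L : ℝ)⁻¹) ^ n) b₀ p₀) K 0)))
    (fun K => Measure.map (unitA (F.refine n) ℰp K)
      ((gibbsK (F.refine n) ℰp (γ * ((F.L : ℝ)⁻¹) ^ n) K).restrict
        (histGood (F.refine n) ℰp (θBal (F.refine n).L (γ * ((F.L : ℝ)⁻¹) ^ n) b₀ p₀) K 0)ᶜ))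
    (fun K => isProbabilityMeasure_unitLaw measurableE_ℰp hγ' K)
    (fun K => unitLaw_eq_map_restrict_add measurableE_ℰp K (hGd K))
    (δ := δ n) (fun K => by rw [real_map_restrict_univ measurableE_ℰp]; exact hmass n K hn₀)
    (lt_of_lt_of_le hn (min_le_right _ _)) hr (fun K => by simpa only [Nat.div_zero] using htilt K)
    (measurable_coarseObs F n ℰp measurableE_ℰp Cs) (abs_coarseObs_le_one F n ℰp Cs)
  refine ⟨n, b, hb, fun K => ?_⟩
  show |(F.scheme ℰp γ).expectAt (K + n) Cs - b K| ≤ ε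
  rw [expectAt_refine F n ℰp measurableE_ℰp hγ.le K Cs]
  exact (hnear K).trans (by linarith [lt_of_lt_of_le hn (min_le_left _ _)])

end Summit.QuantumFields.YangMills.Theorems

end
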